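import Mathlib
import HarnessLib
import Literature.Probability.MarkovChains.MengersenTweedie
import Summits.Ventures.LatticeQCDFlow.Scoring.IMHPoissonTransfer
import Summits.Ventures.LatticeQCDFlow.Scoring.StickingFloorExact
import Summits.Ventures.LatticeQCDFlow.Scoring.VarianceOfTheMean

/-!
# The windowless τ law of the exact flow-MCMC (IMH) chain: the Green–Kubo sum converges

HONEST FRAMING: exact (Metropolis-corrected) sampling algorithms for lattice gauge theory;
figures of merit are autocorrelation/cost numbers at stated couplings and volumes; no
continuum-physics claim.

Venture `LatticeQCDFlow` (cell pub-lqcd), topic `Scoring`; FANOUT row 8 (`s0-cpn-nemc`, GEN-9).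
NEW WORK of the cell (elementary: finite sums, a geometric series), completing the item the flow
seat's offer left open (`HOME/canary-flow/imhlaw/lean/README-lean.md`: "Not formalised: the T → ∞
limit"); the only published input is the Literature rate statement of Mengersen–Tweedie 1996
(`Literature/Probability/MarkovChains/MengersenTweedie.lean`, `imh_tvDist_lawAt_le`: under a weight
bound `p ≤ W · q` the exact IMH chain contracts total variation by `1 − 1/W` per step from every
start), imported, not restated.

## Content (target `p > 0`, `Σ p = 1`; model law `q ≥ 0`, `Σ q = 1`, weight bound `p ≤ W · q` —
## automatic for `q > 0` on a finite space, `weightBound_sum`)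

* `imh_mv_pow_sub_mean_abs_le` — OBSERVABLE CONTRACTION: `|(Kᵗ h)(x) − pᵀh| ≤ 2‖h‖ (1 − 1/W)ᵗ`
  for every function `h` bounded by `‖h‖` (duality with the Literature TV bound from `δ_x`).
* `imh_twoTime_abs_le` — for a CENTRED `c` (`pᵀ c = 0`) the tree's two-time form decays
  geometrically: `|S_t(c, h)| ≤ 2‖h‖ · (Σ_x p_x |c_x|) · (1 − 1/W)ᵗ`; hence `S_T(c, h) → 0`
  (`imh_twoTime_tendsto_zero`) and `t ↦ S_t(c, c)` is summable (`imh_twoTime_summable`).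
* **`imh_greenKubo_hasSum`** — THE WINDOWLESS LAW: if `h` solves the Poisson equation
  `h − K h = c` of the exact chain then `Σ_{t ≥ 0} S_t(c, c) = S_0(c, h) = ⟨c, h⟩_p` as a `HasSum`
  (the finite-horizon identity `Scoring.imh_greenKubo_partial` plus the decay of the boundary term);
  `imh_poisson_inner_eq`: `⟨c, h⟩_p` is the same for every Poisson solution `h`.
* **`imh_tauInt_eq`** — on the tree's `Scoring.tauInt`: for the normalised autocorrelation
  `ρ_t = S_t(c, c)/S_0(c, c)` of a non-degenerate centred observable,
  `τ_int = ⟨c, h⟩_p / ⟨c, c⟩_p − 1/2` — no window, no truncation.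
* `imh_poisson_exists` — a Poisson solution EXISTS for every centred `c` (Neumann series
  `h⋆ = Σ_t Kᵗ c`, convergent by the same decay); with `Scoring.imh_poisson_transfer` this is what
  one back-substitution of Liu's triangular system delivers.
* `imh_summable_moment_acf`, **`imh_tendsto_tauIntN`** — the first absolute moment
  `Σ_t (t+1)|ρ_{t+1}|` of the chain's ACF is finite, so row 11's finite-`N` variance-of-the-mean
  time converges, `τ_N → τ_int` (`Scoring.tendsto_tauIntN` with its hypothesis discharged).
* `autocovA_eq_twoTime`, `summable_acfA_succ`, **`stickingFloor_le_tauInt_of_pos`** — for a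
  positive model law the summability hypothesis `hsum` of `Scoring.stickingFloor_le_tauInt_exact`
  is DISCHARGED: scorer A's sticking floor is below `τ_int(1_A)` of the exact chain for every sector
  `A` with `0 < p(A) < 1`, unconditionally.

Reading (markdown, not a claim beyond the statements): this is the algebra behind the flow seat's
`imhlaw.py` / the gauge seat's `a34_imhlaw.py` (IMH-LAW-flow.md §1 (T1)–(T3)): states = the stored
proposal pool, `q` uniform on it, `p ∝ w`; the `T → ∞` step they take numerically is a theorem on
a finite pool because `w⋆ = max w < ∞` there.
-/

namespace Summit.Ventures.LatticeQCDFlow.Scoring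

open Finset Filter Literature.Probability.MarkovChains Summit.Ventures.LatticeQCDFlow.Exactness

variable {X : Type*} [Fintype X] [DecidableEq X]

/-! ### The weight bound and the contraction rate -/

omit [DecidableEq X] in
/-- For a positive model law on a finite space the weight `w = p/q` is bounded: with
`W := Σ_z p z / q z` one has `p ≤ W · q` pointwise. -/
theorem weightBound_sum {p q : X → ℝ} (hp : ∀ x, 0 ≤ p x) (hq : ∀ x, 0 < q x) (x : X) :
    p x ≤ (∑ z, p z / q z) * q x := by
  have h1 : p x / q x ≤ ∑ z, p z / q z :=
    single_le_sum (f := fun z => p z / q z) (fun z _ => div_nonneg (hp z) (hq z).le) (mem_univ x)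
  calc p x = p x / q x * q x := by rw [div_mul_cancel₀ _ (hq x).ne']
    _ ≤ (∑ z, p z / q z) * q x := mul_le_mul_of_nonneg_right h1 (hq x).le

omit [DecidableEq X] in
/-- Under a weight bound between probability vectors `W ≥ 1`, so the Mengersen–Tweedie rate
`1 − 1/W` lies in `[0, 1)`. -/
theorem rate_nonneg_and_lt_one {p q : X → ℝ} {W : ℝ} (hp1 : ∑ x, p x = 1) (hq1 : ∑ x, q x = 1)
    (hW : ∀ x, p x ≤ W * q x) : 0 ≤ 1 - W⁻¹ ∧ 1 - W⁻¹ < 1 := by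
  have h : ∑ x, p x ≤ ∑ x, W * q x := sum_le_sum fun x _ => hW x
  rw [hp1, ← mul_sum, hq1, mul_one] at h
  have hW0 : 0 < W⁻¹ := inv_pos.2 (one_pos.trans_le h)
  exact ⟨sub_nonneg.2 (inv_le_one_of_one_le₀ h), by linarith⟩

/-! ### Observable contraction from the Literature total-variation bound -/

/-- **Observable contraction**: `|(Kᵗ h)(x) − pᵀh| ≤ 2‖h‖ (1 − 1/W)ᵗ` for every `h` with
`|h| ≤ H`, every start `x` and every `t` — the dual of `imh_tvDist_lawAt_le` from `δ_x`. -/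
theorem imh_mv_pow_sub_mean_abs_le {p q : X → ℝ} {W : ℝ} (hp : ∀ x, 0 < p x)
    (hp1 : ∑ x, p x = 1) (hq : ∀ x, 0 ≤ q x) (hq1 : ∑ x, q x = 1) (hW : ∀ x, p x ≤ W * q x)
    (h : X → ℝ) {H : ℝ} (hH : ∀ y, |h y| ≤ H) (x : X) (t : ℕ) :
    |mv (imhMatrix p q ^ t) h x - ∑ y, p y * h y| ≤ 2 * H * (1 - W⁻¹) ^ t := by
  have hlaw : ∀ y, (imhMatrix p q ^ t) x y = lawAt (imhKernel p q) (Pi.single x 1) t y :=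
    fun y => (lawAt_single_eq_pow (imhKernel p q) x t y).symm
  have hdiff : mv (imhMatrix p q ^ t) h x - ∑ y, p y * h y
      = ∑ y, (lawAt (imhKernel p q) (Pi.single x 1) t y - p y) * h y := by
    simp only [mv, hlaw, sub_mul, sum_sub_distrib]
  have h1 : ∑ y, (Pi.single x 1 : X → ℝ) y = 1 := by simp [sum_pi_single']
  have htv : tvDist (lawAt (imhKernel p q) (Pi.single x 1) t) p ≤ (1 - W⁻¹) ^ t :=
    imh_tvDist_lawAt_le hp hp1 hq hq1 hW (fun y => single_one_nonneg x y) h1 t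
  have hH0 : 0 ≤ H := (abs_nonneg _).trans (hH x)
  rw [hdiff]
  calc |∑ y, (lawAt (imhKernel p q) (Pi.single x 1) t y - p y) * h y|
      ≤ ∑ y, |(lawAt (imhKernel p q) (Pi.single x 1) t y - p y) * h y| :=
        abs_sum_le_sum_abs _ _
    _ ≤ ∑ y, |lawAt (imhKernel p q) (Pi.single x 1) t y - p y| * H := by
        refine sum_le_sum fun y _ => ?_
        rw [abs_mul]
        exact mul_le_mul_of_nonneg_left (hH y) (abs_nonneg _)
    _ = 2 * H * tvDist (lawAt (imhKernel p q) (Pi.single x 1) t) p := by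
        rw [← sum_mul, tvDist]; ring
    _ ≤ 2 * H * (1 - W⁻¹) ^ t := mul_le_mul_of_nonneg_left htv (by positivity)

/-! ### Geometric decay of the two-time form against a centred observable -/

/-- **`|S_t(c, h)| ≤ 2‖h‖ · (Σ_x p_x |c_x|) · (1 − 1/W)ᵗ`** for centred `c` (`pᵀ c = 0`): subtract
the vanishing `(pᵀc)(pᵀh)` and use the observable contraction state by state. -/
theorem imh_twoTime_abs_le {p q : X → ℝ} {W : ℝ} (hp : ∀ x, 0 < p x) (hp1 : ∑ x, p x = 1)
    (hq : ∀ x, 0 ≤ q x) (hq1 : ∑ x, q x = 1) (hW : ∀ x, p x ≤ W * q x) (c h : X → ℝ)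
    (hc : ∑ x, p x * c x = 0) {H : ℝ} (hH : ∀ y, |h y| ≤ H) (t : ℕ) :
    |twoTime p (imhMatrix p q) t c h| ≤ 2 * H * (∑ x, p x * |c x|) * (1 - W⁻¹) ^ t := by
  have hcentre : twoTime p (imhMatrix p q) t c h
      = ∑ x, p x * c x * (mv (imhMatrix p q ^ t) h x - ∑ y, p y * h y) := by
    have h0 : ∑ x, p x * c x * ∑ y, p y * h y = 0 := by rw [← sum_mul, hc, zero_mul]
    unfold twoTime
    simp only [mul_sub, sum_sub_distrib, h0, sub_zero]
  rw [hcentre]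
  calc |∑ x, p x * c x * (mv (imhMatrix p q ^ t) h x - ∑ y, p y * h y)|
      ≤ ∑ x, |p x * c x * (mv (imhMatrix p q ^ t) h x - ∑ y, p y * h y)| :=
        abs_sum_le_sum_abs _ _
    _ ≤ ∑ x, p x * |c x| * (2 * H * (1 - W⁻¹) ^ t) := by
        refine sum_le_sum fun x _ => ?_
        rw [abs_mul, abs_mul, abs_of_pos (hp x)]
        exact mul_le_mul_of_nonneg_left (imh_mv_pow_sub_mean_abs_le hp hp1 hq hq1 hW h hH x t)
          (mul_nonneg (hp x).le (abs_nonneg _))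
    _ = 2 * H * (∑ x, p x * |c x|) * (1 - W⁻¹) ^ t := by rw [← sum_mul]; ring

/-- Hence the boundary term of the finite Green–Kubo identity vanishes: `S_T(c, h) → 0`. -/
theorem imh_twoTime_tendsto_zero {p q : X → ℝ} {W : ℝ} (hp : ∀ x, 0 < p x)
    (hp1 : ∑ x, p x = 1) (hq : ∀ x, 0 ≤ q x) (hq1 : ∑ x, q x = 1) (hW : ∀ x, p x ≤ W * q x)
    (c h : X → ℝ) (hc : ∑ x, p x * c x = 0) :
    Tendsto (fun T => twoTime p (imhMatrix p q) T c h) atTop (nhds 0) := by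
  obtain ⟨hr0, hr1⟩ := rate_nonneg_and_lt_one hp1 hq1 hW
  have hH : ∀ y, |h y| ≤ ∑ z, |h z| :=
    fun y => single_le_sum (f := fun z => |h z|) (fun z _ => abs_nonneg (h z)) (mem_univ y)
  have hg : Tendsto (fun T : ℕ => 2 * (∑ z, |h z|) * (∑ x, p x * |c x|) * (1 - W⁻¹) ^ T)
      atTop (nhds 0) := by
    simpa using (tendsto_pow_atTop_nhds_zero_of_lt_one hr0 hr1).const_mul
      (2 * (∑ z, |h z|) * (∑ x, p x * |c x|))
  refine squeeze_zero_norm (fun T => ?_) hg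
  rw [Real.norm_eq_abs]
  exact imh_twoTime_abs_le hp hp1 hq hq1 hW c h hc hH T

/-- … and the autocovariance sequence `t ↦ S_t(c, c)` of a centred observable is summable
(dominated by a geometric series). -/
theorem imh_twoTime_summable {p q : X → ℝ} {W : ℝ} (hp : ∀ x, 0 < p x) (hp1 : ∑ x, p x = 1)
    (hq : ∀ x, 0 ≤ q x) (hq1 : ∑ x, q x = 1) (hW : ∀ x, p x ≤ W * q x) (c : X → ℝ)
    (hc : ∑ x, p x * c x = 0) : Summable fun t => twoTime p (imhMatrix p q) t c c := by
  obtain ⟨hr0, hr1⟩ := rate_nonneg_and_lt_one hp1 hq1 hW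
  have hH : ∀ y, |c y| ≤ ∑ z, |c z| :=
    fun y => single_le_sum (f := fun z => |c z|) (fun z _ => abs_nonneg (c z)) (mem_univ y)
  refine Summable.of_norm_bounded
    (((summable_geometric_of_lt_one hr0 hr1).mul_left
      (2 * (∑ z, |c z|) * (∑ x, p x * |c x|)))) fun t => ?_
  rw [Real.norm_eq_abs]
  exact imh_twoTime_abs_le hp hp1 hq hq1 hW c c hc hH t

/-! ### The windowless Green–Kubo law -/

/-- **Green–Kubo for the exact flow-MCMC chain, infinite horizon.**  If `c` is centred
(`pᵀ c = 0`) and `h` solves the Poisson equation `h x − Σ_y K x y h y = c x`, then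
`Σ_{t ≥ 0} S_t(c, c) = S_0(c, h) = Σ_x p_x c_x h_x`. -/
theorem imh_greenKubo_hasSum {p q : X → ℝ} {W : ℝ} (hp : ∀ x, 0 < p x) (hp1 : ∑ x, p x = 1)
    (hq : ∀ x, 0 ≤ q x) (hq1 : ∑ x, q x = 1) (hW : ∀ x, p x ≤ W * q x) (c h : X → ℝ)
    (hc : ∑ x, p x * c x = 0) (hh : ∀ x, h x - ∑ y, imhKernel p q x y * h y = c x) :
    HasSum (fun t => twoTime p (imhMatrix p q) t c c) (twoTime p (imhMatrix p q) 0 c h) := by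
  rw [(imh_twoTime_summable hp hp1 hq hq1 hW c hc).hasSum_iff_tendsto_nat]
  have hpart : (fun T => ∑ t ∈ range T, twoTime p (imhMatrix p q) t c c)
      = fun T => twoTime p (imhMatrix p q) 0 c h - twoTime p (imhMatrix p q) T c h :=
    funext fun T => imh_greenKubo_partial p q c h hh T
  rw [hpart]
  simpa using (imh_twoTime_tendsto_zero hp hp1 hq hq1 hW c h hc).const_sub
    (twoTime p (imhMatrix p q) 0 c h)

/-- The inner product `⟨c, h⟩_p = S_0(c, h)` does not depend on WHICH Poisson solution `h` is
used (they differ by constants, invisible to a centred `c`): it is the Green–Kubo sum. -/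
theorem imh_poisson_inner_eq {p q : X → ℝ} {W : ℝ} (hp : ∀ x, 0 < p x) (hp1 : ∑ x, p x = 1)
    (hq : ∀ x, 0 ≤ q x) (hq1 : ∑ x, q x = 1) (hW : ∀ x, p x ≤ W * q x) (c h h' : X → ℝ)
    (hc : ∑ x, p x * c x = 0) (hh : ∀ x, h x - ∑ y, imhKernel p q x y * h y = c x)
    (hh' : ∀ x, h' x - ∑ y, imhKernel p q x y * h' y = c x) :
    twoTime p (imhMatrix p q) 0 c h = twoTime p (imhMatrix p q) 0 c h' :=
  (imh_greenKubo_hasSum hp hp1 hq hq1 hW c h hc hh).unique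
    (imh_greenKubo_hasSum hp hp1 hq hq1 hW c h' hc hh')

/-- **The windowless τ law** on the tree's `tauInt` (`τ_int = 1/2 + Σ_{t ≥ 1} ρ_t`): for a centred
observable with `S_0(c, c) ≠ 0` and any Poisson solution `h`,
`τ_int(ρ) = S_0(c, h) / S_0(c, c) − 1/2 = ⟨c, h⟩_p / ⟨c, c⟩_p − 1/2`. -/
theorem imh_tauInt_eq {p q : X → ℝ} {W : ℝ} (hp : ∀ x, 0 < p x) (hp1 : ∑ x, p x = 1)
    (hq : ∀ x, 0 ≤ q x) (hq1 : ∑ x, q x = 1) (hW : ∀ x, p x ≤ W * q x) (c h : X → ℝ)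
    (hc : ∑ x, p x * c x = 0) (hh : ∀ x, h x - ∑ y, imhKernel p q x y * h y = c x)
    (hC0 : twoTime p (imhMatrix p q) 0 c c ≠ 0) :
    tauInt (fun t => twoTime p (imhMatrix p q) t c c / twoTime p (imhMatrix p q) 0 c c)
      = twoTime p (imhMatrix p q) 0 c h / twoTime p (imhMatrix p q) 0 c c - 1 / 2 := by
  have hGK := imh_greenKubo_hasSum hp hp1 hq hq1 hW c h hc hh
  have h1 : HasSum (fun t => twoTime p (imhMatrix p q) (t + 1) c c)
      (twoTime p (imhMatrix p q) 0 c h - twoTime p (imhMatrix p q) 0 c c) := by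
    have := (hasSum_nat_add_iff' (f := fun t => twoTime p (imhMatrix p q) t c c) 1).2 hGK
    simpa [sum_range_one] using this
  unfold tauInt
  rw [(h1.div_const (twoTime p (imhMatrix p q) 0 c c)).tsum_eq]
  field_simp
  ring

/-! ### A Poisson solution exists (Neumann series) -/

/-- **Existence of the Poisson solution** for every centred `c`: the Neumann series
`h⋆ x = Σ_{t ≥ 0} (Kᵗ c)(x)` converges (each term is bounded by `2‖c‖ (1 − 1/W)ᵗ`) and solves
`h⋆ − K h⋆ = c`. -/
theorem imh_poisson_exists {p q : X → ℝ} {W : ℝ} (hp : ∀ x, 0 < p x) (hp1 : ∑ x, p x = 1)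
    (hq : ∀ x, 0 ≤ q x) (hq1 : ∑ x, q x = 1) (hW : ∀ x, p x ≤ W * q x) (c : X → ℝ)
    (hc : ∑ x, p x * c x = 0) :
    ∃ h : X → ℝ, ∀ x, h x - ∑ y, imhKernel p q x y * h y = c x := by
  obtain ⟨hr0, hr1⟩ := rate_nonneg_and_lt_one hp1 hq1 hW
  have hH : ∀ y, |c y| ≤ ∑ z, |c z| :=
    fun y => single_le_sum (f := fun z => |c z|) (fun z _ => abs_nonneg (c z)) (mem_univ y)
  have hs : ∀ x, Summable fun t => mv (imhMatrix p q ^ t) c x := by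
    intro x
    refine Summable.of_norm_bounded
      ((summable_geometric_of_lt_one hr0 hr1).mul_left (2 * ∑ z, |c z|)) fun t => ?_
    rw [Real.norm_eq_abs]
    have hb := imh_mv_pow_sub_mean_abs_le hp hp1 hq hq1 hW c hH x t
    rwa [hc, sub_zero] at hb
  refine ⟨fun x => ∑' t, mv (imhMatrix p q ^ t) c x, fun x => ?_⟩
  have hstep : ∀ t, ∑ y, imhKernel p q x y * mv (imhMatrix p q ^ t) c y
      = mv (imhMatrix p q ^ (t + 1)) c x := by
    intro t
    rw [pow_succ', mv_mul]
    simp only [mv, imhMatrix_apply]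
  have h1 : ∑ y, imhKernel p q x y * ∑' t, mv (imhMatrix p q ^ t) c y
      = ∑' t, mv (imhMatrix p q ^ (t + 1)) c x := by
    have hmul : ∀ y, imhKernel p q x y * ∑' t, mv (imhMatrix p q ^ t) c y
        = ∑' t, imhKernel p q x y * mv (imhMatrix p q ^ t) c y :=
      fun y => ((hs y).tsum_mul_left _).symm
    simp_rw [hmul]
    rw [← Summable.tsum_finsetSum (fun y _ => (hs y).mul_left _)]
    exact tsum_congr hstep
  show (∑' t, mv (imhMatrix p q ^ t) c x)
      - ∑ y, imhKernel p q x y * ∑' t, mv (imhMatrix p q ^ t) c y = c x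
  rw [h1, (hs x).tsum_eq_zero_add]
  simp [mv_one]

/-! ### Row 11's finite-`N` variance of the mean: `τ_N → τ_int` for the exact chain -/

/-- The first absolute moment of the exact chain's normalised ACF is finite:
`Σ_t (t+1) |ρ_{t+1}| < ∞` for `ρ_t = S_t(c, c)/S_0(c, c)`, `c` centred (geometric decay; for a
degenerate `S_0(c, c) = 0` the sequence is `0` by Lean's `x/0 = 0`). -/
theorem imh_summable_moment_acf {p q : X → ℝ} {W : ℝ} (hp : ∀ x, 0 < p x) (hp1 : ∑ x, p x = 1)
    (hq : ∀ x, 0 ≤ q x) (hq1 : ∑ x, q x = 1) (hW : ∀ x, p x ≤ W * q x) (c : X → ℝ)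
    (hc : ∑ x, p x * c x = 0) :
    Summable fun t : ℕ => ((t : ℝ) + 1) *
      |twoTime p (imhMatrix p q) (t + 1) c c / twoTime p (imhMatrix p q) 0 c c| := by
  obtain ⟨hr0, hr1⟩ := rate_nonneg_and_lt_one hp1 hq1 hW
  have hH : ∀ y, |c y| ≤ ∑ z, |c z| :=
    fun y => single_le_sum (f := fun z => |c z|) (fun z _ => abs_nonneg (c z)) (mem_univ y)
  have hg : Summable fun t : ℕ => ((t : ℝ) + 1) * (1 - W⁻¹) ^ (t + 1) := by
    have hn : ‖(1 : ℝ) - W⁻¹‖ < 1 := by rwa [Real.norm_eq_abs, abs_of_nonneg hr0]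
    have h0 : Summable fun n : ℕ => (n : ℝ) ^ 1 * (1 - W⁻¹) ^ n :=
      summable_pow_mul_geometric_of_norm_lt_one 1 hn
    have h1 : Summable fun n : ℕ => (((n + 1 : ℕ) : ℝ)) ^ 1 * (1 - W⁻¹) ^ (n + 1) :=
      (summable_nat_add_iff (f := fun n : ℕ => (n : ℝ) ^ 1 * (1 - W⁻¹) ^ n) 1).2 h0
    refine h1.congr fun t => ?_
    rw [pow_one, Nat.cast_add, Nat.cast_one]
  refine Summable.of_norm_bounded (hg.mul_left
    (2 * (∑ z, |c z|) * (∑ x, p x * |c x|) / |twoTime p (imhMatrix p q) 0 c c|)) fun t => ?_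
  have ht : (0 : ℝ) ≤ (t : ℝ) + 1 := by positivity
  rw [Real.norm_eq_abs, abs_mul, abs_of_nonneg ht, abs_abs, abs_div]
  have hb := imh_twoTime_abs_le hp hp1 hq hq1 hW c c hc hH (t + 1)
  calc ((t : ℝ) + 1) *
        (|twoTime p (imhMatrix p q) (t + 1) c c| / |twoTime p (imhMatrix p q) 0 c c|)
      ≤ ((t : ℝ) + 1) * (2 * (∑ z, |c z|) * (∑ x, p x * |c x|) * (1 - W⁻¹) ^ (t + 1) /
          |twoTime p (imhMatrix p q) 0 c c|) :=
        mul_le_mul_of_nonneg_left (div_le_div_of_nonneg_right hb (abs_nonneg _)) ht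
    _ = 2 * (∑ z, |c z|) * (∑ x, p x * |c x|) / |twoTime p (imhMatrix p q) 0 c c| *
          (((t : ℝ) + 1) * (1 - W⁻¹) ^ (t + 1)) := by ring

/-- **`τ_N → τ_int` for every centred observable of the exact flow-MCMC chain** (row 11's
`Scoring.tendsto_tauIntN` — the finite-`N` variance of the mean in units of `σ²/(2N)` converges to
the figure of merit — with its moment hypothesis supplied by `imh_summable_moment_acf`). -/
theorem imh_tendsto_tauIntN {p q : X → ℝ} {W : ℝ} (hp : ∀ x, 0 < p x) (hp1 : ∑ x, p x = 1)
    (hq : ∀ x, 0 ≤ q x) (hq1 : ∑ x, q x = 1) (hW : ∀ x, p x ≤ W * q x) (c : X → ℝ)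
    (hc : ∑ x, p x * c x = 0) :
    Tendsto
      (fun N => tauIntN
        (fun t => twoTime p (imhMatrix p q) t c c / twoTime p (imhMatrix p q) 0 c c) N)
      atTop
      (nhds (tauInt fun t => twoTime p (imhMatrix p q) t c c / twoTime p (imhMatrix p q) 0 c c)) :=
  tendsto_tauIntN (imh_summable_moment_acf hp hp1 hq hq1 hW c hc)

/-! ### Corollaries for a positive model law: the sector indicator's τ_int -/

omit [DecidableEq X] in
/-- The centred version of any observable is centred: `Σ_x p_x (f x − pᵀf) = 0` (`Σ p = 1`). -/
theorem sum_mul_centred_eq_zero {p : X → ℝ} (hp1 : ∑ x, p x = 1) (f : X → ℝ) :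
    ∑ x, p x * (f x - ∑ y, p y * f y) = 0 := by
  simp only [mul_sub, sum_sub_distrib, ← sum_mul, hp1, one_mul, sub_self]

/-- The sector autocovariance of `Scoring/StickingFloorExact.lean` IS the tree's two-time form of
the centred indicator: `C_t(1_A) = S_t(1_A − p(A), 1_A − p(A))`. -/
theorem autocovA_eq_twoTime (p q : X → ℝ) (A : Finset X) (t : ℕ) :
    autocovA p q A t = twoTime p (imhMatrix p q) t
      (fun x => (if x ∈ A then 1 else 0) - mass p A)
      (fun x => (if x ∈ A then 1 else 0) - mass p A) := by
  rw [twoTime_eq_sum]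
  unfold autocovA
  refine sum_congr rfl fun x _ => sum_congr rfl fun y _ => ?_
  rw [lawAt_single_eq_pow]
  rfl

/-- The centred indicator is centred: `Σ_x p_x (1_A(x) − p(A)) = 0`. -/
theorem sum_mul_centredIndicator_eq_zero {p : X → ℝ} (hp1 : ∑ x, p x = 1) (A : Finset X) :
    ∑ x, p x * ((if x ∈ A then (1 : ℝ) else 0) - mass p A) = 0 := by
  have hm : mass p A = ∑ x, p x * (if x ∈ A then (1 : ℝ) else 0) := by
    unfold mass
    simp only [mul_ite, mul_one, mul_zero]
    rw [sum_ite_mem, univ_inter]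
  simp only [mul_sub, sum_sub_distrib, ← sum_mul, hp1, one_mul, hm, sub_self]

/-- **For a positive model law the sector ACF is summable** (geometric decay at the
Mengersen–Tweedie rate): the hypothesis `hsum` of `stickingFloor_le_tauInt_exact`, discharged. -/
theorem summable_acfA_succ {p q : X → ℝ} (hp : ∀ x, 0 < p x) (hp1 : ∑ x, p x = 1)
    (hq : ∀ x, 0 < q x) (hq1 : ∑ x, q x = 1) (A : Finset X) :
    Summable fun t : ℕ => acfA p q A (t + 1) := by
  have hW := weightBound_sum (fun x => (hp x).le) hq
  have hs := imh_twoTime_summable hp hp1 (fun x => (hq x).le) hq1 hW _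
    (sum_mul_centredIndicator_eq_zero hp1 A)
  have hs' : Summable fun t : ℕ => autocovA p q A t := by
    refine hs.congr fun t => ?_
    rw [autocovA_eq_twoTime]
  unfold acfA
  exact ((summable_nat_add_iff 1).2 hs').div_const _

/-- **Scorer A's sticking floor is below `τ_int(1_A)` of the exact flow-MCMC chain, unconditionally,
for every positive model law** and every sector with `0 < p(A) < 1`
(`Scoring.stickingFloor_le_tauInt_exact` with its summability input supplied by
`summable_acfA_succ`). -/
theorem stickingFloor_le_tauInt_of_pos {p q : X → ℝ} (hp : ∀ x, 0 < p x) (hp1 : ∑ x, p x = 1)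
    (hq : ∀ x, 0 < q x) (hq1 : ∑ x, q x = 1) {A : Finset X} (hA0 : 0 < mass p A)
    (hA1 : mass p A < 1) :
    stickingFloor (mass p A) (max 0 (1 - (∑ x ∈ A, q x) / mass p A)) ≤ tauInt (acfA p q A) :=
  stickingFloor_le_tauInt_exact hp hp1 (fun x => (hq x).le) hq1 hA0 hA1
    (summable_acfA_succ hp hp1 hq hq1 A)

end Summit.Ventures.LatticeQCDFlow.Scoring
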